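import Mathlib
import HarnessLib
import Summits.NavierStokesRegularity.NavierStokesRegularity.Theorems.WakeRatchetMinimalViscousBlowupUpperBlock

/-!
# Route `WakeRatchet`, crux `MinimalViscousBlowup` (stmt-NavierStokesRegularity-22743) — LINE g12-2 (ns-idea-1 g12, card «monotone quantity hunt»):
# (FC′) ⇒ LIT MEASURE AT THE DARKNESS LEVEL (H1″)

ns-idea-1 g12's kernel-checked §7 of `lines/g12-2/Reignition_dev.lean` v3/v4 (tree form `lines/g12-2/tree/WakeRatchetMinimalViscousBlowupRetreatDepth.lean`
4b629150786ea543 §7), landed VERBATIM by the hand ns-qj-p1 g7 (the tree's split of the author's files: `…ShellFence` §1–§2 · `…UpperBlock` §3 ·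
`…Reignition` §4 · `…LevelGrowth` §5 · `…RetreatDepth` §6 · this file §7 · `…ClockResidueIff` §8–§9 · `…FrontClockResidue`).
* `litMeasure_of_frontClock₂` — along a trajectory of the `ν`-viscous lattice on `[0,T)` with the cascade datum, the fired front clock
  `T − t ≤ Kλ^{−2m}` (shell `m` fired by `t`) bounds the time shell `k` spends above the darkness level `ν²/(32768λ¹⁹)` by `max(T, Kλ²)·λ^{−2k}`:
  a shell `k ≥ 1` can exceed that level only after its feeder `k−1` has FIRED (an unfired feeder is a closed valve with EMPTY data above,
  `upperBlock_maxPrinciple` with `L₀ = 0`, capping shell `k` below darkness), and then the feeder's clock applies.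
MODEL lattice only (nothing about Navier–Stokes; no NS regularity statement is proved).  `--supports stmt-NavierStokesRegularity-22743 --as helper`.
[cite: Tao2016AveragedNS, §4 (4.3), Lemma 4.1 (4.5), §5; BarbatoMorandinRomito2011, §3.1]
-/

noncomputable section

set_option linter.dupNamespace false

open Set Filter Topology MeasureTheory
open Literature.Analysis.FluidPDE Literature.Analysis.FluidPDE.TaoCascade

namespace Summit.NavierStokesRegularity.NavierStokesRegularity.Theorems.MinimalViscousBlowup.ThresholdRay

/-! ### §7 (FC′) ⇒ lit measure at the darkness level -/

/-- **(FC′) ⇒ (H1″): lit measure at the DARKNESS level.**  Along a trajectory of the `ν`-viscous lattice on `[0,T)` with the cascade datum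
(shells `≠ 0` empty at `t = 0`), the fired front clock `T − t ≤ Kλ^{−2m}` (shell `m` fired by `t`) bounds the time shell `k` spends above the
darkness level `ν²/(32768λ¹⁹)` by `max(T, Kλ²)·λ^{−2k}`: a shell `k ≥ 1` can exceed that level at time `s` only after its feeder `k−1` has FIRED —
as long as shell `k−1` stays below the firing level `ν²/(32768λ¹⁶)` it is a closed valve with empty data above (`upperBlock_maxPrinciple`,
`L₀ = 0`), capping shell `k` at `ν²/(65536λ³²) <` darkness — and then the clock for `k−1` gives `s ≥ T − Kλ²λ^{−2k}`.  With
`retreatDepth_of_frontClock` and `frontClock_of_litMeasure_retreatDepth₂` (FrontClockResidue v3): **(FC′) ⟺ (H1″) ∧ (H2″)** along enveloped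
blow-ups, all in kernel.  MODEL lattice only. [cite: Tao2016AveragedNS, §4 (4.3), §5] -/
theorem litMeasure_of_frontClock₂ {ε₀ ν T K : ℝ} (hε : 0 < ε₀) (hν : 0 < ν)
    {α : Fin 4 → Fin 4 → Fin 4 → ℤ × ℤ × ℤ → ℝ} (hcan : IsCancellingCoeff α)
    (hα1 : ∀ i₁ i₂ i₃, |α i₁ i₂ i₃ (0, 0, 1)| ≤ 1) {X : Fin 4 → ℤ → ℝ → ℝ} {X₀ : Fin 4 → ℝ}
    (hcd : ∀ i n, ContDiffOn ℝ 1 (X i n) (Ico 0 T))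
    (hinit : ∀ i n, X i n 0 = if n = 0 then X₀ i else 0)
    (hmot : ∀ i n t, 0 ≤ t → t < T → derivWithin (X i n) (Ici 0) t =
      quadTerm ε₀ α X i n t - ν * (1 + ε₀) ^ ((2 : ℝ) * n) * X i n t)
    (hreg : ∀ T' : ℝ, 0 < T' → T' < T → ∃ M : ℝ, ∀ t : ℝ, 0 ≤ t → t ≤ T' →
      ∀ (i : Fin 4) (n : ℤ), (1 + (1 + ε₀) ^ ((10 : ℝ) * n)) * |X i n t| ≤ M)
    (hFC : ∀ (m : ℕ) (t : ℝ), 0 ≤ t → t < T →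
      (∃ s, 0 ≤ s ∧ s ≤ t ∧ 1 / (32768 * (1 + ε₀) ^ 16) * ν ^ 2 ≤ (1 + ε₀) ^ m * ‖shellVec X m s‖ ^ 2) →
      T - t ≤ K / (1 + ε₀) ^ (2 * m)) :
    ∀ k : ℕ, volume {s : ℝ | 0 ≤ s ∧ s < T ∧
        1 / (32768 * (1 + ε₀) ^ 19) * ν ^ 2 < (1 + ε₀) ^ k * ‖shellVec X k s‖ ^ 2} ≤
      ENNReal.ofReal (max T (K * (1 + ε₀) ^ 2) * ((1 + ε₀) ^ 2)⁻¹ ^ k) := by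
  have hl0 : (0 : ℝ) < 1 + ε₀ := by linarith
  have hl1 : (1 : ℝ) < 1 + ε₀ := by linarith
  have hν2 : 0 < ν ^ 2 := pow_pos hν 2
  set q : ℝ := ((1 + ε₀) ^ 2)⁻¹ with hq
  have hq0 : 0 < q := by rw [hq]; positivity
  intro k
  cases k with
  | zero =>
    have hsub : {s : ℝ | 0 ≤ s ∧ s < T ∧ 1 / (32768 * (1 + ε₀) ^ 19) * ν ^ 2 <
        (1 + ε₀) ^ (0 : ℕ) * ‖shellVec X ((0 : ℕ) : ℤ) s‖ ^ 2} ⊆ Ico 0 T := fun s hs => ⟨hs.1, hs.2.1⟩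
    calc volume {s : ℝ | 0 ≤ s ∧ s < T ∧ 1 / (32768 * (1 + ε₀) ^ 19) * ν ^ 2 <
          (1 + ε₀) ^ (0 : ℕ) * ‖shellVec X ((0 : ℕ) : ℤ) s‖ ^ 2}
        ≤ volume (Ico (0 : ℝ) T) := measure_mono hsub
      _ = ENNReal.ofReal (T - 0) := Real.volume_Ico
      _ ≤ ENNReal.ofReal (max T (K * (1 + ε₀) ^ 2) * q ^ 0) :=
          ENNReal.ofReal_le_ofReal (by rw [pow_zero, mul_one, sub_zero]; exact le_max_left _ _)
  | succ p =>
    -- the level cap behind an unfired valve: `16384 b₀² ν² ≤` darkness level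
    have hkey : 16384 * (1 / (32768 * (1 + ε₀) ^ 16)) ^ 2 ≤ 1 / (32768 * (1 + ε₀) ^ 19) := by
      have ha : (0 : ℝ) < (1 + ε₀) ^ 16 := by positivity
      rw [show (16384 : ℝ) * (1 / (32768 * (1 + ε₀) ^ 16)) ^ 2 = 1 / (65536 * ((1 + ε₀) ^ 16) ^ 2) by
        field_simp; ring]
      apply one_div_le_one_div_of_le (by positivity)
      have h1 : (1 + ε₀) ^ 19 ≤ ((1 + ε₀) ^ 16) ^ 2 := by
        rw [← pow_mul]; exact pow_le_pow_right₀ hl1.le (by norm_num)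
      nlinarith [h1]
    have hb₀L : 1 / (32768 * (1 + ε₀) ^ 16) * ν ^ 2 < ν ^ 2 / 16384 := by
      rw [lt_div_iff₀ (by norm_num)]
      have : 1 / (32768 * (1 + ε₀) ^ 16) < 1 / 16384 := by
        apply one_div_lt_one_div_of_lt (by norm_num)
        have : (1 : ℝ) ≤ (1 + ε₀) ^ 16 := one_le_pow₀ hl1.le
        nlinarith
      nlinarith
    -- data above shell `p` vanish at `t = 0`
    have h0 : ∀ m : ℕ, p < m → (1 + ε₀) ^ m * ‖shellVec X m 0‖ ^ 2 ≤ 0 := by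
      intro m hm
      have hz : ‖shellVec X (m : ℤ) 0‖ ^ 2 = 0 := by
        rw [norm_shellVec_sq]
        refine Finset.sum_eq_zero fun i _ => ?_
        rw [hinit i (m : ℤ), if_neg (by omega)]
        ring
      rw [hz, mul_zero]
    have hconv : K * (1 + ε₀) ^ 2 * q ^ (p + 1) = K / (1 + ε₀) ^ (2 * p) := by
      rw [hq, inv_pow, ← pow_mul, show 2 * (p + 1) = 2 * p + 2 by ring, pow_add]
      field_simp
    have hsub : {s : ℝ | 0 ≤ s ∧ s < T ∧ 1 / (32768 * (1 + ε₀) ^ 19) * ν ^ 2 <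
        (1 + ε₀) ^ (p + 1) * ‖shellVec X ((p + 1 : ℕ) : ℤ) s‖ ^ 2} ⊆ Icc (T - K * (1 + ε₀) ^ 2 * q ^ (p + 1)) T := by
      rintro s ⟨hs0, hsT, hlit⟩
      refine ⟨?_, hsT.le⟩
      -- the feeder `p` has fired by `s`
      have hfired : ∃ τ, 0 ≤ τ ∧ τ ≤ s ∧ 1 / (32768 * (1 + ε₀) ^ 16) * ν ^ 2 ≤ (1 + ε₀) ^ p * ‖shellVec X p τ‖ ^ 2 := by
        by_contra hnf
        push Not at hnf
        have hmax := upperBlock_maxPrinciple hε hν hcan hα1 hcd hmot hreg le_rfl hs0 hsT (k := p) (L₀ := 0)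
          (L₁ := 1 / (32768 * (1 + ε₀) ^ 16) * ν ^ 2) le_rfl (by positivity) hb₀L
          (fun τ h0τ hτs => (hnf τ h0τ hτs).le) h0 s hs0 le_rfl (p + 1) (Nat.lt_succ_self p)
        have hcap : max 0 (16384 * (1 / (32768 * (1 + ε₀) ^ 16) * ν ^ 2) ^ 2 / ν ^ 2) ≤
            1 / (32768 * (1 + ε₀) ^ 19) * ν ^ 2 := by
          refine max_le (by positivity) ?_
          rw [div_le_iff₀ hν2]
          have := mul_le_mul_of_nonneg_right hkey (mul_nonneg hν2.le hν2.le)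
          calc 16384 * (1 / (32768 * (1 + ε₀) ^ 16) * ν ^ 2) ^ 2
              = 16384 * (1 / (32768 * (1 + ε₀) ^ 16)) ^ 2 * (ν ^ 2 * ν ^ 2) := by ring
            _ ≤ 1 / (32768 * (1 + ε₀) ^ 19) * (ν ^ 2 * ν ^ 2) := this
            _ = 1 / (32768 * (1 + ε₀) ^ 19) * ν ^ 2 * ν ^ 2 := by ring
        linarith [hmax.trans hcap]
      have hclock := hFC p s hs0 hsT hfired
      rw [← hconv] at hclock
      linarith
    calc volume {s : ℝ | 0 ≤ s ∧ s < T ∧ 1 / (32768 * (1 + ε₀) ^ 19) * ν ^ 2 <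
          (1 + ε₀) ^ (p + 1) * ‖shellVec X ((p + 1 : ℕ) : ℤ) s‖ ^ 2}
        ≤ volume (Icc (T - K * (1 + ε₀) ^ 2 * q ^ (p + 1)) T) := measure_mono hsub
      _ = ENNReal.ofReal (T - (T - K * (1 + ε₀) ^ 2 * q ^ (p + 1))) := Real.volume_Icc
      _ = ENNReal.ofReal (K * (1 + ε₀) ^ 2 * q ^ (p + 1)) := by congr 1; ring
      _ ≤ ENNReal.ofReal (max T (K * (1 + ε₀) ^ 2) * q ^ (p + 1)) :=
          ENNReal.ofReal_le_ofReal (mul_le_mul_of_nonneg_right (le_max_right _ _) (pow_nonneg hq0.le _))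

end Summit.NavierStokesRegularity.NavierStokesRegularity.Theorems.MinimalViscousBlowup.ThresholdRay
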